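import Literature.Topology.FourManifolds.PontryaginThomBoundingManifold
import Literature.Topology.FourManifolds.NullCobordismComponents
import HarnessLib

/-!
# Discharge of Kervaire–Milnor's Lemma 4.2 `⇒` (`boundsParallelizable_of_collapseNullHomotopic`)

Topic `Literature/Topology/FourManifolds`; pure-proof file attached to
`PontryaginThomCollapse.lean`, discharging its named fact
`Literature.Topology.FourManifolds.boundsParallelizable_of_collapseNullHomotopic`
— Kervaire–Milnor, *Groups of homotopy spheres I*, Ann. of Math. 77 (1963), Lemma 4.2, p. 510:
*"The subset `p(M) ⊂ Πₙ` contains the zero element of `Πₙ` if and only if `M` bounds a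
parallelizable manifold"*, direction `⇒`: *"if `p(M, φ) ≃ 0`, then `M` bounds a manifold
`W ⊂ Dⁿ⁺ᵏ⁺¹`, where `φ` extends to a field `ψ` of normal frames over `W`.  It follows from
Lemmas 3.3 and 3.4 that `W` is parallelizable."*

The proof assembled here follows the printed one:

1. (`PontryaginThomTransversality.lean`) the null-homotopy of the collapse, read radially on
   `ℝⁿ⁺ᵏ⁺¹ ∖ 0`, is smoothed relative to the tube end and made transverse to a point `y` near `0`
   (Sard);
2. (`RegularValuePreimage.lean`) the level is an embedded `(n+1)`-manifold `Z` with
   `TZ = ker dG`;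
3. (`PontryaginThomBoundingManifold.lean`) `W = Z ∩ {‖p‖ ≥ 1}` is a compact manifold with boundary
   `≅ M`, stably parallelised by peeling the gradient frame of its normal bundle
   (`PontryaginThomLevelFraming.lean`, `StableRangeFramePeel.lean`, `ImmersedFramePullback.lean`:
   Lemmas 3.3 and 3.5);
4. (`NullCobordismComponents.lean`) the components of `W` meeting `∂W` are parallelisable
   (Lemma 3.4, `HomotopySpheresSignatureProofs.lean`), in dimension `n + 1 ≥ 2`; in dimension `1`
   a stably trivial line bundle is trivial; an empty `M` bounds the empty manifold.

No definition, no named fact and no statement is added or changed (net debt `-1`).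

## References

* M. Kervaire, J. Milnor, *Groups of homotopy spheres I*, Ann. of Math. (2) 77 (1963), 504–537,
  Lemma 4.2 and its proof (p. 510), Lemmas 3.3–3.5 (p. 509). doi:10.2307/1970128
  [KervaireMilnorAnnals1963]
* A. Kosinski, *Differential Manifolds* (1993), Ch. IX (5.5), Ch. IV (1.4). [Kosinski1993]
-/

open scoped Manifold ContDiff Topology
open Set Function Module Bundle TopologicalSpace

noncomputable section

namespace Literature.Topology.FourManifolds

/-- **An empty manifold bounds a parallelisable manifold** (the empty one: the empty open subset
of the model half-space). [folklore] -/
theorem boundsParallelizable_of_isEmpty (n : ℕ) (M : Type) [TopologicalSpace M]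
    [ChartedSpace (EuclideanSpace ℝ (Fin n)) M] [IsEmpty M] : BoundsParallelizable n M := by
  set W : Opens (EuclideanHalfSpace (n + 1)) := ⊥ with hW
  haveI hWe : IsEmpty W := ⟨fun x ↦ (x.2 : x.1 ∈ (⊥ : Opens (EuclideanHalfSpace (n + 1))))⟩
  set incl : M → W := fun x ↦ isEmptyElim x with hincl
  have hemb : Manifold.IsSmoothEmbedding (𝓡 n) (𝓡∂ (n + 1)) ∞ incl := by
    refine ⟨⟨Fin 1 → ℝ, inferInstance, inferInstance, fun x ↦ isEmptyElim x⟩, ?_⟩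
    haveI : Subsingleton M := ⟨fun x ↦ isEmptyElim x⟩
    exact ⟨⟨Subsingleton.elim _ _⟩, injective_of_subsingleton _⟩
  let c : NullCobordism n M :=
    { W := W
      incl := incl
      isSmoothEmbedding_incl := hemb
      range_incl := by
        rw [Set.range_eq_empty incl, eq_comm]
        exact Set.eq_empty_of_isEmpty _ }
  refine ⟨c, fun i x ↦ isEmptyElim x, fun i ↦ ?_, fun x ↦ isEmptyElim x⟩
  exact continuous_def.2 fun s _ ↦ by rw [Set.eq_empty_of_isEmpty (_ ⁻¹' s)]; exact isOpen_empty

/-- **Kervaire–Milnor's Lemma 4.2, `⇒`** — discharge of the named fact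
`boundsParallelizable_of_collapseNullHomotopic`: if the Pontryagin–Thom collapse of a framed
tubular embedding `M × ℝᵏ ↪ Sⁿ⁺ᵏ`, `k > n + 1`, of a closed `n`-manifold `M` is null-homotopic,
then `M` bounds a parallelisable compact manifold.  Transversality of the smoothed radial
null-homotopy to a Sard-regular value, the regular value theorem, the gradient frame of the normal
bundle peeled down to a stable framing (Lemmas 3.3, 3.5) and Lemma 3.4 on the components meeting
the boundary; empty `M` and `n = 0` treated directly.
[cite: KervaireMilnorAnnals1963, Lemma 4.2 and its proof (p. 510), Lemmas 3.3–3.5 (p. 509)] -/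
theorem boundsParallelizable_of_collapseNullHomotopic_holds :
    boundsParallelizable_of_collapseNullHomotopic := by
  intro n k M _ _ _ _ _ _ E hk hE
  rcases isEmpty_or_nonempty M with hM | hM
  · exact boundsParallelizable_of_isEmpty n M
  · obtain ⟨c, hc⟩ := E.exists_nullCobordism_isStablyParallelizable (by omega) hE
    cases n with
    | zero => exact ⟨c, c.isParallelizable_of_isStablyParallelizable_zero hc⟩
    | succ n =>
      obtain ⟨c', hc'⟩ := c.exists_isParallelizable_of_isStablyParallelizable_succ hc
      exact ⟨c', hc'⟩

end Literature.Topology.FourManifolds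

end
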